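import Literature.AnabelianGeometry.SemiGraphs.TemperedPiPointSeqFibreIso
import Literature.AnabelianGeometry.SemiGraphs.TemperedPiDecompositionConj
import Literature.AnabelianGeometry.SemiGraphs.TemperedPiDecompositionStab
import Literature.AnabelianGeometry.SemiGraphs.TemperedPiTreeCosetIso
import HarnessLib

/-!
# Apartments of a Galois tower along a ray of closed edges ([SemiAnbd] Rmk 2.2.1, Thm 3.7 (i)/(iii) pp. 24, 40–41)

Mochizuki, *Semi-graphs of anabelioids*, Publ. RIMS **42** (2006) [MochizukiSemiAnbd2006], Remark 2.2.1
p. 24 ("the image of each `Π_v` (respectively, `Π_b`) in `Π_𝒢` is equal to the stabilizer of a compatible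
system of vertices (respectively, edges)") and Theorem 3.7 (i)/(iii) pp. 40–41 ("natural continuous,
injective outer homomorphism `π̂₁(𝒢_v) ↪ π₁^temp(𝒢)`", "a compatible system of vertices of `𝒢_{∞,j}`",
"such images of `π̂₁(𝒢_e)`'s … edge-like subgroups"). [cite: MochizukiSemiAnbd2006, Thm 3.7(iii) pp.40-41]

PROOF-ONLY file (abc-iut cell, FRONTIER programme REFUTE-F1732, brick R6c (c1); seat abc-iut-L3-t11
gen 3; no named facts; the only `def`s are the concrete point / edge sequences of the apartment, built from
abc-iut-L3-t6's `PointSeq` / `EdgeSeq` / `gluePointSeq`).  For a Galois tower `D : GaloisLevelData 𝒢`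
(abc-iut-L3-t9) and a RAY of closed edges of `𝔾` — vertices `v k`, branches `βm k` (abutting to `v k`)
and `βp k` (abutting to `v (k+1)`) of one edge `𝒢.graph.edgeOf (βm k) = 𝒢.graph.edgeOf (βp k)` — and a
compatible point sequence `P₀` over `v 0`, the file builds the APARTMENT of the tower along the ray:

* `PointSeq.toEdgeSeq` — un-gluing a point sequence over `w` along a branch `b` at `w` (the edge-point
  sequence `glue_b⁻¹ (P.pt n)`), with `gluePointSeq_toEdgeSeq : (P.toEdgeSeq b hb).gluePointSeq b … = P`;
* `rayPointSeq P₀ k : D.PointSeq (v k)` and `rayEdgeSeq P₀ k : D.EdgeSeq (edgeOf (βm k))`, defined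
  RECURSIVELY: un-glue `rayPointSeq k` along `βm k`, glue along `βp k` to get `rayPointSeq (k+1)`
  (`rayPointSeq_succ`, `gluePointSeq_rayEdgeSeq`);
* the decomposition homomorphisms: `ψ_k := (rayPointSeq k).decompHom : Π_{v k} →* π₁^temp` are verticial
  (t8, by name) and the edge homomorphism of `rayEdgeSeq k` is BOTH `ψ_k ∘ (βm k)_*`
  (`decompHomE_rayEdgeSeq`) AND `ψ_{k+1} ∘ (βp k)_*` (`decompHomE_rayEdgeSeq_apply_succ`, pointwise, the
  edge type transported along `edgeOf (βp k) = edgeOf (βm k)`): the ALIGNMENT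
  `ψ_{k+1} ∘ (βp k)_* = ψ_k ∘ (βm k)_*` on `Π_{e_k}` asked for by abc-iut-L3-d1's R6-SPEC (BS1′) holds by
  construction, with no conjugator choice;
* the tree apartment: compatible vertex systems `(rayPointSeq k).vertex n` over `v k`
  (`treeProj_vertexMap_rayVertex`) and edge systems `(rayEdgeSeq k).edge n`, fixed by the images of
  `ψ_k` resp. of the edge homomorphism; in particular the EDGE GENERATORS
  `z k x := ψ_{k+1} ((βp k)_* x)` fix `(rayPointSeq k).vertex n`, `(rayPointSeq (k+1)).vertex n` and
  `(rayEdgeSeq k).edge n` at every level (`treeAct_rayGen_*`).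

Consumer: abc-iut-L3-d4's escape criterion (R6-level (E)/(c2)/(c5)) at the desk countermodel `𝒢_θ` of
abc-iut-L3-d1 (memo HOME/staging/L3/L3-d1/g3/COUNTERMODEL-Thm37iii-infinite.md): `z k 1 → c`, `c` compact,
escaping — towards a kernel erratum for the ∀-countable reading of [SemiAnbd] Thm 3.7 (iii) ([IUTchI] Rmk
2.5.3); print proves finite `𝔾` (kernel: `compactInVerticialAt_of_finiteGraph`).  Nothing here bears on
[IUTchIII] Cor. 3.12; typed ≠ proved.
-/

namespace Literature.AnabelianGeometry.SemiGraphs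

namespace ProfiniteSemiGraph

namespace GaloisLevelData

open CategoryTheory Topology

universe u

variable {𝒢 : ProfiniteSemiGraph.{u}} {D : GaloisLevelData 𝒢} {h𝒢 : 𝒢.IsCountable}

/-! ### Gluing along a branch of an edge given up to an equation -/

namespace EdgeSeq

variable {e : 𝒢.graph.Edge} (Q : D.EdgeSeq h𝒢 e) (hc : 𝒢.graph.IsConnected)
  (b : 𝒢.graph.Branch) (v : 𝒢.graph.Vertex) (hb : 𝒢.graph.abuts b = some v)
  (hbe : 𝒢.graph.edgeOf b = e)

/-- The points of the glued sequence, for a branch of an edge given up to the equation `hbe`.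
[cite: MochizukiSemiAnbd2006, Thm 3.7(iii) p.41] -/
theorem gluePointSeq_pt_of_eq (n : ℕ) :
    (Q.gluePointSeq b v hb hbe).pt n = ((D.cover h𝒢 n).glue b v hb).hom.hom.hom (hbe ▸ Q.pt n) := by
  subst hbe
  rfl

/-- **The edge decomposition homomorphism is the vertex one composed with `b_*`, pointwise, for a branch
of an edge given up to the equation `hbe`** (abc-iut-L3-t8's `decompHomE_eq_decompHom_comp_brHom`
transported along `hbe`). [cite: MochizukiSemiAnbd2006, Thm 3.7(iii) p.41] -/
theorem decompHomE_apply_of_eq (x : 𝒢.Ge (𝒢.graph.edgeOf b)) :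
    Q.decompHomE hc (hbe ▸ x) = (Q.gluePointSeq b v hb hbe).decompHom (𝒢.brHom b v hb x) := by
  subst hbe
  exact DFunLike.congr_fun (Q.decompHomE_eq_decompHom_comp_brHom hc b v hb) x

end EdgeSeq

/-! ### Un-gluing a point sequence along a branch -/

namespace PointSeq

variable {w : 𝒢.graph.Vertex} (P : D.PointSeq h𝒢 w) (b : 𝒢.graph.Branch)
  (hb : 𝒢.graph.abuts b = some w)

/-- **Un-gluing a point sequence along a branch `b` at `w`**: the edge-point sequence `glue_b⁻¹ (P.pt n)`
over the edge of `b` (compatible since the covering maps of the tower commute with the gluings).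
[cite: MochizukiSemiAnbd2006, Thm 3.7(iii) p.41] -/
noncomputable def toEdgeSeq : D.EdgeSeq h𝒢 (𝒢.graph.edgeOf b) where
  pt n := ((D.cover h𝒢 n).glue b w hb).inv.hom.hom (P.pt n)
  compat n := by
    apply Function.LeftInverse.injective ((D.cover h𝒢 n).glue_inv_hom b w hb)
    rw [CovHom.glue_fE, (D.cover h𝒢 (n + 1)).glue_hom_inv, (D.cover h𝒢 n).glue_hom_inv, P.compat n]

/-- The points of the un-glued sequence. [cite: MochizukiSemiAnbd2006, Thm 3.7(iii) p.41] -/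
theorem toEdgeSeq_pt (n : ℕ) :
    (P.toEdgeSeq b hb).pt n = ((D.cover h𝒢 n).glue b w hb).inv.hom.hom (P.pt n) := rfl

/-- **Gluing back the un-glued sequence along the same branch gives the point sequence.**
[cite: MochizukiSemiAnbd2006, Thm 3.7(iii) p.41] -/
theorem gluePointSeq_toEdgeSeq : (P.toEdgeSeq b hb).gluePointSeq b w hb rfl = P := by
  apply PointSeq.ext
  intro n
  rw [EdgeSeq.gluePointSeq_pt, toEdgeSeq_pt, (D.cover h𝒢 n).glue_hom_inv]

/-- **The edge homomorphism of the un-glued sequence is `P.decompHom ∘ b_*`.**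
[cite: MochizukiSemiAnbd2006, Thm 3.7(iii) p.41] -/
theorem decompHomE_toEdgeSeq (hc : 𝒢.graph.IsConnected) :
    (P.toEdgeSeq b hb).decompHomE hc = P.decompHom.comp (𝒢.brHom b w hb).toMonoidHom := by
  rw [(P.toEdgeSeq b hb).decompHomE_eq_decompHom_comp_brHom hc b w hb, P.gluePointSeq_toEdgeSeq b hb]

/-- The tree vertex of a point sequence over `w` lies over `w`. [cite: MochizukiSemiAnbd2006, Thm 3.7(iii) p.41] -/
theorem treeProj_vertexMap_vertex (n : ℕ) : (D.treeProj n).vertexMap (P.vertex n) = w := by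
  change ((D.treeIso h𝒢 n).hom ≫ D.treeProj n).vertexMap (Quot.mk _ ⟨w, P.pt n⟩) = w
  rw [D.treeIso_hom_comp_treeProj h𝒢 n]
  rfl

end PointSeq

/-! ### The apartment along a ray of closed edges -/

section Ray

variable (hc : 𝒢.graph.IsConnected)
  {v : ℕ → 𝒢.graph.Vertex} {βm βp : ℕ → 𝒢.graph.Branch}
  (ham : ∀ k, 𝒢.graph.abuts (βm k) = some (v k))
  (hap : ∀ k, 𝒢.graph.abuts (βp k) = some (v (k + 1)))
  (hmp : ∀ k, 𝒢.graph.edgeOf (βp k) = 𝒢.graph.edgeOf (βm k))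
  (P₀ : D.PointSeq h𝒢 (v 0))

/-- **The point sequences of the apartment**: `rayPointSeq 0 = P₀`, and `rayPointSeq (k+1)` is obtained
from `rayPointSeq k` by un-gluing along `βm k` and gluing along `βp k` (the other branch of the same edge).
[cite: MochizukiSemiAnbd2006, Thm 3.7(iii) p.41] -/
noncomputable def rayPointSeq : (k : ℕ) → D.PointSeq h𝒢 (v k)
  | 0 => P₀
  | k + 1 => ((rayPointSeq k).toEdgeSeq (βm k) (ham k)).gluePointSeq (βp k) (v (k + 1)) (hap k) (hmp k)

/-- **The edge sequences of the apartment**: `rayEdgeSeq k` is `rayPointSeq k` un-glued along `βm k`.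
[cite: MochizukiSemiAnbd2006, Thm 3.7(iii) p.41] -/
noncomputable def rayEdgeSeq (k : ℕ) : D.EdgeSeq h𝒢 (𝒢.graph.edgeOf (βm k)) :=
  (rayPointSeq ham hap hmp P₀ k).toEdgeSeq (βm k) (ham k)

/-- `rayPointSeq 0 = P₀`. [cite: MochizukiSemiAnbd2006, Thm 3.7(iii) p.41] -/
theorem rayPointSeq_zero : rayPointSeq ham hap hmp P₀ 0 = P₀ := rfl

/-- `rayPointSeq (k+1)` is `rayEdgeSeq k` glued along `βp k`. [cite: MochizukiSemiAnbd2006, Thm 3.7(iii) p.41] -/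
theorem rayPointSeq_succ (k : ℕ) :
    rayPointSeq ham hap hmp P₀ (k + 1) =
      (rayEdgeSeq ham hap hmp P₀ k).gluePointSeq (βp k) (v (k + 1)) (hap k) (hmp k) := rfl

/-- `rayPointSeq k` is `rayEdgeSeq k` glued along `βm k`. [cite: MochizukiSemiAnbd2006, Thm 3.7(iii) p.41] -/
theorem gluePointSeq_rayEdgeSeq (k : ℕ) :
    (rayEdgeSeq ham hap hmp P₀ k).gluePointSeq (βm k) (v k) (ham k) rfl = rayPointSeq ham hap hmp P₀ k :=
  (rayPointSeq ham hap hmp P₀ k).gluePointSeq_toEdgeSeq (βm k) (ham k)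

/-- The edge points of the apartment, downstairs: `glue_{βm k} (rayEdgeSeq k).pt n = (rayPointSeq k).pt n`.
[cite: MochizukiSemiAnbd2006, Thm 3.7(iii) p.41] -/
theorem glue_rayEdgeSeq_pt (k n : ℕ) :
    ((D.cover h𝒢 n).glue (βm k) (v k) (ham k)).hom.hom.hom ((rayEdgeSeq ham hap hmp P₀ k).pt n) =
      (rayPointSeq ham hap hmp P₀ k).pt n := by
  change ((D.cover h𝒢 n).glue (βm k) (v k) (ham k)).hom.hom.hom
    (((D.cover h𝒢 n).glue (βm k) (v k) (ham k)).inv.hom.hom _) = _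
  rw [(D.cover h𝒢 n).glue_hom_inv]

/-- The edge points of the apartment, upstairs: `glue_{βp k} (rayEdgeSeq k).pt n = (rayPointSeq (k+1)).pt n`
(the edge type transported along `hmp k`). [cite: MochizukiSemiAnbd2006, Thm 3.7(iii) p.41] -/
theorem glue_rayEdgeSeq_pt_succ (k n : ℕ) :
    ((D.cover h𝒢 n).glue (βp k) (v (k + 1)) (hap k)).hom.hom.hom (hmp k ▸ (rayEdgeSeq ham hap hmp P₀ k).pt n) =
      (rayPointSeq ham hap hmp P₀ (k + 1)).pt n := by
  rw [rayPointSeq_succ, EdgeSeq.gluePointSeq_pt_of_eq]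

/-! ### The decomposition homomorphisms of the apartment: alignment -/

/-- **The edge homomorphism of the `k`-th edge of the apartment is `ψ_k ∘ (βm k)_*`**, `ψ_k` the
decomposition homomorphism of `rayPointSeq k`. [cite: MochizukiSemiAnbd2006, Thm 3.7(iii) p.41] -/
theorem decompHomE_rayEdgeSeq (k : ℕ) :
    (rayEdgeSeq ham hap hmp P₀ k).decompHomE hc =
      (rayPointSeq ham hap hmp P₀ k).decompHom.comp (𝒢.brHom (βm k) (v k) (ham k)).toMonoidHom :=
  (rayPointSeq ham hap hmp P₀ k).decompHomE_toEdgeSeq (βm k) (ham k) hc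

/-- **… and it is also `ψ_{k+1} ∘ (βp k)_*`** (pointwise, the edge type transported along `hmp k`): the
ALIGNMENT `ψ_{k+1} ∘ (βp k)_* = ψ_k ∘ (βm k)_*` on `Π_{e_k}`. [cite: MochizukiSemiAnbd2006, Thm 3.7(iii) p.41] -/
theorem decompHomE_rayEdgeSeq_apply_succ (k : ℕ) (x : 𝒢.Ge (𝒢.graph.edgeOf (βp k))) :
    (rayEdgeSeq ham hap hmp P₀ k).decompHomE hc (hmp k ▸ x) =
      (rayPointSeq ham hap hmp P₀ (k + 1)).decompHom (𝒢.brHom (βp k) (v (k + 1)) (hap k) x) := by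
  rw [rayPointSeq_succ]
  exact (rayEdgeSeq ham hap hmp P₀ k).decompHomE_apply_of_eq hc (βp k) (v (k + 1)) (hap k) (hmp k) x

include hc in
/-- The alignment in the form consumed at `𝒢_θ`: for `x : Π_{e_k}` (typed over `βp k`) and its transport
`hmp k ▸ x` (typed over `βm k`), `ψ_{k+1} ((βp k)_* x) = ψ_k ((βm k)_* (hmp k ▸ x))`.
[cite: MochizukiSemiAnbd2006, Thm 3.7(iii) p.41] -/
theorem decompHom_brHom_succ_eq (k : ℕ) (x : 𝒢.Ge (𝒢.graph.edgeOf (βp k))) :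
    (rayPointSeq ham hap hmp P₀ (k + 1)).decompHom (𝒢.brHom (βp k) (v (k + 1)) (hap k) x) =
      (rayPointSeq ham hap hmp P₀ k).decompHom (𝒢.brHom (βm k) (v k) (ham k) (hmp k ▸ x)) := by
  rw [← decompHomE_rayEdgeSeq_apply_succ hc ham hap hmp P₀ k x, decompHomE_rayEdgeSeq hc ham hap hmp P₀ k]
  rfl

/-! ### The tree apartment: vertices, edges, heights, and what the generators fix -/

/-- The vertices of the apartment lie over the ray: `(rayPointSeq k).vertex n` lies over `v k`.
[cite: MochizukiSemiAnbd2006, Thm 3.7(iii) p.41] -/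
theorem treeProj_vertexMap_rayVertex (k n : ℕ) :
    (D.treeProj n).vertexMap ((rayPointSeq ham hap hmp P₀ k).vertex n) = v k :=
  (rayPointSeq ham hap hmp P₀ k).treeProj_vertexMap_vertex n

/-- The vertices of the apartment are compatible under the transition maps of the trees.
[cite: MochizukiSemiAnbd2006, Thm 3.7(iii) p.41] -/
theorem treeTrans_rayVertex (k : ℕ) {i j : ℕ} (h : i ≤ j) :
    (D.treeTrans h).vertexMap ((rayPointSeq ham hap hmp P₀ k).vertex j) =
      (rayPointSeq ham hap hmp P₀ k).vertex i :=
  (rayPointSeq ham hap hmp P₀ k).treeTrans_vertex h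

/-- The edges of the apartment are compatible under the transition maps of the trees.
[cite: MochizukiSemiAnbd2006, Thm 3.7(iii) p.41] -/
theorem treeTrans_rayEdge (k : ℕ) {i j : ℕ} (h : i ≤ j) :
    (D.treeTrans h).edgeMap ((rayEdgeSeq ham hap hmp P₀ k).edge j) = (rayEdgeSeq ham hap hmp P₀ k).edge i :=
  (rayEdgeSeq ham hap hmp P₀ k).treeTrans_edge h

/-- **The image of `ψ_k` fixes the `k`-th vertex of the apartment at every level.**
[cite: MochizukiSemiAnbd2006, Thm 3.7(iii) p.41] -/
theorem treeAct_rayDecompHom_vertexMap (k n : ℕ) (h : 𝒢.Gv (v k)) :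
    (D.treeAct h𝒢 n ((rayPointSeq ham hap hmp P₀ k).decompHom h)).hom.vertexMap
        ((rayPointSeq ham hap hmp P₀ k).vertex n) =
      (rayPointSeq ham hap hmp P₀ k).vertex n :=
  (rayPointSeq ham hap hmp P₀ k).treeAct_decompHom_vertexMap n h

/-- **The edge generators `z_k(x) := ψ_{k+1} ((βp k)_* x)` fix the `(k+1)`-st vertex of the apartment.**
[cite: MochizukiSemiAnbd2006, Thm 3.7(iii) p.41] -/
theorem treeAct_rayGen_vertexMap_succ (k n : ℕ) (x : 𝒢.Ge (𝒢.graph.edgeOf (βp k))) :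
    (D.treeAct h𝒢 n ((rayPointSeq ham hap hmp P₀ (k + 1)).decompHom
        (𝒢.brHom (βp k) (v (k + 1)) (hap k) x))).hom.vertexMap
        ((rayPointSeq ham hap hmp P₀ (k + 1)).vertex n) =
      (rayPointSeq ham hap hmp P₀ (k + 1)).vertex n :=
  (rayPointSeq ham hap hmp P₀ (k + 1)).treeAct_decompHom_vertexMap n _

include hc in
/-- **… and fix the `k`-th vertex of the apartment** (by the alignment).
[cite: MochizukiSemiAnbd2006, Thm 3.7(iii) p.41] -/
theorem treeAct_rayGen_vertexMap (k n : ℕ) (x : 𝒢.Ge (𝒢.graph.edgeOf (βp k))) :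
    (D.treeAct h𝒢 n ((rayPointSeq ham hap hmp P₀ (k + 1)).decompHom
        (𝒢.brHom (βp k) (v (k + 1)) (hap k) x))).hom.vertexMap
        ((rayPointSeq ham hap hmp P₀ k).vertex n) =
      (rayPointSeq ham hap hmp P₀ k).vertex n := by
  rw [decompHom_brHom_succ_eq hc ham hap hmp P₀ k x]
  exact (rayPointSeq ham hap hmp P₀ k).treeAct_decompHom_vertexMap n _

include hc in
/-- **… and fix the `k`-th edge of the apartment.** [cite: MochizukiSemiAnbd2006, Thm 3.7(iii) p.41] -/
theorem treeAct_rayGen_edgeMap (k n : ℕ) (x : 𝒢.Ge (𝒢.graph.edgeOf (βp k))) :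
    (D.treeAct h𝒢 n ((rayPointSeq ham hap hmp P₀ (k + 1)).decompHom
        (𝒢.brHom (βp k) (v (k + 1)) (hap k) x))).hom.edgeMap
        ((rayEdgeSeq ham hap hmp P₀ k).edge n) =
      (rayEdgeSeq ham hap hmp P₀ k).edge n := by
  rw [← decompHomE_rayEdgeSeq_apply_succ hc ham hap hmp P₀ k x]
  exact (rayEdgeSeq ham hap hmp P₀ k).treeAct_decompHomE_edgeMap hc n _

include hc in
/-- Summary: an element of `Π_{e_k}` acts, through the edge generator `z_k`, trivially on the `k`-th vertex,
the `k`-th edge and the `(k+1)`-st vertex of the apartment, at every level.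
[cite: MochizukiSemiAnbd2006, Thm 3.7(iii) p.41] -/
theorem treeAct_rayGen_fixes (k n : ℕ) (x : 𝒢.Ge (𝒢.graph.edgeOf (βp k))) :
    (D.treeAct h𝒢 n ((rayPointSeq ham hap hmp P₀ (k + 1)).decompHom
        (𝒢.brHom (βp k) (v (k + 1)) (hap k) x))).hom.vertexMap
        ((rayPointSeq ham hap hmp P₀ k).vertex n) = (rayPointSeq ham hap hmp P₀ k).vertex n ∧
    (D.treeAct h𝒢 n ((rayPointSeq ham hap hmp P₀ (k + 1)).decompHom
        (𝒢.brHom (βp k) (v (k + 1)) (hap k) x))).hom.edgeMap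
        ((rayEdgeSeq ham hap hmp P₀ k).edge n) = (rayEdgeSeq ham hap hmp P₀ k).edge n ∧
    (D.treeAct h𝒢 n ((rayPointSeq ham hap hmp P₀ (k + 1)).decompHom
        (𝒢.brHom (βp k) (v (k + 1)) (hap k) x))).hom.vertexMap
        ((rayPointSeq ham hap hmp P₀ (k + 1)).vertex n) = (rayPointSeq ham hap hmp P₀ (k + 1)).vertex n :=
  ⟨treeAct_rayGen_vertexMap hc ham hap hmp P₀ k n x, treeAct_rayGen_edgeMap hc ham hap hmp P₀ k n x,
    treeAct_rayGen_vertexMap_succ ham hap hmp P₀ k n x⟩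

end Ray

end GaloisLevelData

end ProfiniteSemiGraph

end Literature.AnabelianGeometry.SemiGraphs
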